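import Mathlib
import Summits.NavierStokesRegularity.NavierStokesRegularity.Theorems.SubOnsagerCeilingSideBranchShellTransitRelax
import HarnessLib

/-!
# Route SubOnsagerCeiling — the transiting modes of EVERY FINITE BLOCK of `α_SB` relax at a `ν`-uniform time
# (helper file for item stmt-NavierStokesRegularity-25507 `OrthantTailCeiling`; `--supports`; def-free)

Assembly «R-B» for the escape construction behind the conditional refutations of the aside cruxes
`OrthantTailCeiling` (stmt-25507) / `ForwardTailCeiling` (stmt-26608) on the side-branch dead-end table
`α_SB = sideBranchTable` (the remaining debt is fixed-fraction escape, `…SideBranchFractionEscape.lean`).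
On top of the one-shell theorem `sideBranch_shell_transit_relax` (sibling file `…ShellTransitRelax.lean`)
this file chooses the parameters and runs the induction over the shells:

* `sideBranch_shell_transit_step` — ONE SHELL, parameters chosen: for every shell `k ≥ 0`, pocket cap
  `Z > 0` and level `ρ > 0` there are a feed tolerance `φ > 0`, a window length `W > 0` and a viscosity
  threshold `ν₁ > 0` (depending on `k, Z, ρ, ε₀` only) such that along EVERY regular `ν`-viscous solution
  (`0 < ν ≤ ν₁`) on `[0,s]` that is non-negative on the shells `≥ 0` with all pockets `≤ Z`: if the feed is
  quiet, `Λ_{k-1}x_{k-1}² ≤ φ` on `[t₀, s]`, then `x_k(u) ≤ ρ` and `s_k(u) ≤ ρ` for every `u ∈ [t₀ + W, s]`;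
* **`sideBranch_block_transit_relax`** — EVERY FINITE BLOCK: for every depth `K`, cap `Z > 0` and level
  `ρ > 0` there are `T₀ > 0` and `ν₀ > 0` (depending on `K, Z, ρ, ε₀` only) such that along every such
  solution with `0 < ν ≤ ν₀` (no shells below `0`): `x_k(u) ≤ ρ` and `s_k(u) ≤ ρ` for all `k ≤ K` and all
  `u ∈ [T₀, s]`.  (Induction on `K`: the level of the block `0..K` is lowered until its top shell's feed
  `Λ_K x_K²` into shell `K+1` is below that shell's tolerance.)

So, uniformly in small viscosity, at late times the energy a finite block of `α_SB` still holds sits in its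
dead-end POCKETS up to any prescribed `δ` (`sideBranch_block_transit_energy`): «the block keeps energy» ⇒
«the pockets keep energy».  What this does NOT give: any bound on how much the pockets hold (that is the
fixed-fraction escape debt).

HONEST FRAMING: elementary real analysis of a Tao-type MODEL lattice ODE (route SubOnsagerCeiling, rung
TL-M2Break); a brick toward a construction that is NOT carried out here; nothing bears on Navier–Stokes
regularity; no crux is settled here. [cite: Tao2016AveragedNS, §4 (4.2)–(4.3)];
Katz–Pavlović couplings: [cite: BarbatoMorandinRomito2011, §2].
-/

noncomputable section

-- the sub-problem namespace `NavierStokesRegularity.NavierStokesRegularity` is the tree's layout (D-0017)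
set_option linter.dupNamespace false

namespace Summit.NavierStokesRegularity.NavierStokesRegularity.Theorems.SubOnsagerCeiling

open Set
open Literature.Analysis.FluidPDE.TaoCascade

/-! ## One shell, parameters chosen -/

/-- **One shell of `α_SB` relaxes behind a quiet feed (parameters chosen, `ν`-uniform).**  For a shell
`k ≥ 0`, a pocket cap `Z > 0` and a level `ρ > 0` there are `φ, W, ν₁ > 0` such that: along every regular
solution of the `ν`-viscous `α_SB` lattice on `[0,s]` with `0 < ν ≤ ν₁`, non-negative on the shells `≥ 0`
and with every pocket `z_j ≤ Z` on `[0,s]`, if `Λ_{k-1}x_{k-1}² ≤ φ` on `[t₀,s]` (`t₀ ≥ 0`) then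
`x_k(u) ≤ ρ` and `s_k(u) ≤ ρ` for all `u ∈ [t₀ + W, s]`.  (`σ = ρ/2`, `Δ = 10Z/(Λ_kσ²)+1`,
`r = min(ρ/2, 1, 5σ/(4Λ_kΔ))`, `L = (1+log 2)/(Λ_kZ/5) + 4Z/Q + 1` with
`Q = (Λ_k/5)(Λ_k r²/(5(Λ_kZ/5+1)))²`, `φ = r/L`, `W = L + Δ`,
`ν₁ = min(1/(b^{2(k+1)}L), 1/(b^{2(k+1)}Δ), b^{-2k})`; then `sideBranch_shell_transit_relax`.) [this file] -/
theorem sideBranch_shell_transit_step {ε₀ : ℝ} (hε : 0 < ε₀) (k : ℤ) (hk : 0 ≤ k) {Z ρ : ℝ}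
    (hZ : 0 < Z) (hρ : 0 < ρ) :
    ∃ φ : ℝ, 0 < φ ∧ ∃ W : ℝ, 0 < W ∧ ∃ ν₁ : ℝ, 0 < ν₁ ∧
      ∀ ν : ℝ, 0 < ν → ν ≤ ν₁ → ∀ (s : ℝ) (X : Fin 4 → ℤ → ℝ → ℝ),
        (∀ (i : Fin 4) (j : ℤ), ∀ t ∈ Icc (0 : ℝ) s, HasDerivWithinAt (X i j)
          (quadTerm ε₀ sideBranchTable X i j t - ν * (1 + ε₀) ^ ((2 : ℝ) * j) * X i j t)
          (Icc (0 : ℝ) s) t) →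
        (∀ t ∈ Icc (0 : ℝ) s, ∀ (i : Fin 4) (j : ℤ), 0 ≤ j → 0 ≤ X i j t) →
        (∀ t ∈ Icc (0 : ℝ) s, ∀ j : ℤ, X 2 j t ≤ Z) →
        ∀ t₀ : ℝ, 0 ≤ t₀ →
        (∀ u ∈ Icc t₀ s, (1 + ε₀) ^ ((5 : ℝ) * ((k : ℝ) - 1) / 2) * X 0 (k - 1) u ^ 2 ≤ φ) →
        ∀ u ∈ Icc (t₀ + W) s, X 0 k u ≤ ρ ∧ X 1 k u ≤ ρ := by
  have hb : (0 : ℝ) < 1 + ε₀ := by linarith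
  set Λ : ℝ := (1 + ε₀) ^ ((5 : ℝ) * k / 2) with hΛ
  have hΛ0 : 0 < Λ := Real.rpow_pos_of_pos hb _
  set b2k : ℝ := (1 + ε₀) ^ ((2 : ℝ) * k) with hb2k
  have hb2k0 : 0 < b2k := Real.rpow_pos_of_pos hb _
  set b2k1 : ℝ := (1 + ε₀) ^ ((2 : ℝ) * ((k + 1 : ℤ) : ℝ)) with hb2k1
  have hb2k10 : 0 < b2k1 := Real.rpow_pos_of_pos hb _
  -- the parameters
  set σ : ℝ := ρ / 2 with hσdef
  have hσ : 0 < σ := by positivity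
  set Δ : ℝ := 10 * Z / (Λ * σ ^ 2) + 1 with hΔdef
  have hΔ0 : 0 < Δ := by
    have h1 : 0 ≤ 10 * Z / (Λ * σ ^ 2) := by positivity
    rw [hΔdef]; linarith
  set r : ℝ := min (min (ρ / 2) 1) (5 * σ / (4 * Λ * Δ)) with hrdef
  have hr : 0 < r := lt_min (lt_min (by positivity) one_pos) (by positivity)
  have hrρ : r ≤ ρ / 2 := (min_le_left _ _).trans (min_le_left _ _)
  have hr1 : r ≤ 1 := (min_le_left _ _).trans (min_le_right _ _)
  have hrσ' : r ≤ 5 * σ / (4 * Λ * Δ) := min_le_right _ _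
  set r₁m : ℝ := (1 / 5 : ℝ) * Λ * Z with hr₁m
  have hr₁m0 : 0 < r₁m := by positivity
  set r₁p : ℝ := (1 / 5 : ℝ) * Λ * Z + 1 with hr₁p
  have hr₁p0 : 0 < r₁p := by positivity
  set Q : ℝ := (1 / 5 : ℝ) * Λ * (Λ * r ^ 2 / (5 * r₁p)) ^ 2 with hQdef
  have hQ0 : 0 < Q := by positivity
  set L : ℝ := (1 + Real.log 2) / r₁m + 4 * Z / Q + 1 with hLdef
  have hlog2 : 0 ≤ Real.log 2 := Real.log_nonneg (by norm_num)
  have hL0 : 0 < L := by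
    have h1 : 0 ≤ (1 + Real.log 2) / r₁m := by positivity
    have h2 : 0 ≤ 4 * Z / Q := by positivity
    rw [hLdef]; linarith
  set φ : ℝ := r / L with hφdef
  have hφ : 0 < φ := by positivity
  set ν₁ : ℝ := min (min (1 / (b2k1 * L)) (1 / (b2k1 * Δ))) (1 / b2k) with hν₁def
  have hν₁ : 0 < ν₁ := lt_min (lt_min (by positivity) (by positivity)) (by positivity)
  refine ⟨φ, hφ, L + Δ, by linarith, ν₁, hν₁, ?_⟩
  intro ν hν hνle s X hder hpos hcap t₀ ht₀ hfeed u hu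
  have hus : u ≤ s := hu.2
  have ht₀u : t₀ ≤ u := by linarith [hu.1]
  have hsub : Icc t₀ u ⊆ Icc (0 : ℝ) s := Icc_subset_Icc ht₀ hus
  -- viscosity-dependent quantities
  have hνL : ν * b2k1 * L ≤ 1 := by
    have h1 : ν ≤ 1 / (b2k1 * L) := hνle.trans ((min_le_left _ _).trans (min_le_left _ _))
    have h2 : ν * (b2k1 * L) ≤ 1 := by
      rw [le_div_iff₀ (by positivity)] at h1; exact h1
    linarith [h2]
  have hνΔ : ν * b2k1 * Δ ≤ 1 := by
    have h1 : ν ≤ 1 / (b2k1 * Δ) := hνle.trans ((min_le_left _ _).trans (min_le_right _ _))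
    have h2 : ν * (b2k1 * Δ) ≤ 1 := by
      rw [le_div_iff₀ (by positivity)] at h1; exact h1
    linarith [h2]
  have hνb : ν * b2k ≤ 1 := by
    have h1 : ν ≤ 1 / b2k := hνle.trans (min_le_right _ _)
    rw [le_div_iff₀ hb2k0] at h1; exact h1
  -- the actual `r₁ = ΛZ/5 + ν_k` lies in `[r₁m, r₁p]`
  set r₁ : ℝ := (1 / 5 : ℝ) * Λ * Z + ν * b2k with hr₁def
  have hr₁lo : r₁m ≤ r₁ := by
    have : 0 ≤ ν * b2k := by positivity
    rw [hr₁def, hr₁m]; linarith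
  have hr₁hi : r₁ ≤ r₁p := by rw [hr₁def, hr₁p]; linarith
  have hr₁0 : 0 < r₁ := hr₁m0.trans_le hr₁lo
  -- the dip condition holds at length `L` for this `ν`
  have hdip : 2 * Z < (1 / 5 : ℝ) * Λ * (Λ * r ^ 2 / (5 * r₁)) ^ 2 * (L - (1 + Real.log 2) / r₁) := by
    -- first factor `≥ Q`
    have h1 : Λ * r ^ 2 / (5 * r₁) ≥ Λ * r ^ 2 / (5 * r₁p) :=
      div_le_div_of_nonneg_left (by positivity) (by positivity) (by linarith)
    have h1' : 0 ≤ Λ * r ^ 2 / (5 * r₁p) := by positivity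
    have h2 : Q ≤ (1 / 5 : ℝ) * Λ * (Λ * r ^ 2 / (5 * r₁)) ^ 2 := by
      rw [hQdef]
      exact mul_le_mul_of_nonneg_left (pow_le_pow_left₀ h1' h1 2) (by positivity)
    -- second factor `≥ L − (1+log2)/r₁m = 4Z/Q + 1`
    have h3 : (1 + Real.log 2) / r₁ ≤ (1 + Real.log 2) / r₁m :=
      div_le_div_of_nonneg_left (by positivity) hr₁m0 hr₁lo
    have h4 : 4 * Z / Q + 1 ≤ L - (1 + Real.log 2) / r₁ := by rw [hLdef]; linarith
    have h5 : 0 ≤ 4 * Z / Q + 1 := by positivity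
    have h6 : Q * (4 * Z / Q + 1) ≤
        (1 / 5 : ℝ) * Λ * (Λ * r ^ 2 / (5 * r₁)) ^ 2 * (L - (1 + Real.log 2) / r₁) :=
      mul_le_mul h2 h4 h5 (hQ0.le.trans h2)
    have h7 : Q * (4 * Z / Q + 1) = 4 * Z + Q := by field_simp
    linarith
  -- side regrowth condition `(4/5)Λr²Δ ≤ σ`
  have hrσ : (4 / 5 : ℝ) * Λ * r ^ 2 * Δ ≤ σ := by
    have h1 : r ^ 2 ≤ r := by nlinarith
    have h2 : r ^ 2 ≤ 5 * σ / (4 * Λ * Δ) := h1.trans hrσ'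
    have h3 : (4 / 5 : ℝ) * Λ * r ^ 2 * Δ = ((4 : ℝ) * Λ * Δ / 5) * r ^ 2 := by ring
    rw [h3]
    have h4 : ((4 : ℝ) * Λ * Δ / 5) * r ^ 2 ≤ ((4 : ℝ) * Λ * Δ / 5) * (5 * σ / (4 * Λ * Δ)) :=
      mul_le_mul_of_nonneg_left h2 (by positivity)
    have h5 : ((4 : ℝ) * Λ * Δ / 5) * (5 * σ / (4 * Λ * Δ)) = σ := by
      field_simp
    linarith
  have hφL : φ * L ≤ r := by
    rw [hφdef, div_mul_cancel₀ r hL0.ne']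
  have hwin : t₀ + L + (10 * Z / ((1 + ε₀) ^ ((5 : ℝ) * k / 2) * σ ^ 2) + 1) ≤ u := by
    rw [← hΛ, ← hΔdef]; linarith [hu.1]
  have hk1 : (0 : ℤ) ≤ k + 1 := by omega
  obtain ⟨hx, hsd⟩ := sideBranch_shell_transit_relax (X := X) hε hν hder k ht₀ hus hr hσ hZ hL0 hwin
    (fun w hw => hfeed w ⟨hw.1, hw.2.trans hus⟩)
    (fun w hw => hpos w (hsub hw) 0 k hk) (fun w hw => hpos w (hsub hw) 0 (k + 1) hk1)
    (fun w hw => hpos w (hsub hw) 1 k hk) (fun w hw => hpos w (hsub hw) 2 (k + 1) hk1)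
    (fun w hw => hcap w (hsub hw) (k + 1)) hφL
    (by rw [← hΛ, ← hΔdef]; exact hrσ)
    (by rw [← hb2k1]; exact hνL)
    (by rw [← hΛ, ← hΔdef, ← hb2k1]; exact hνΔ)
    (by rw [← hΛ, ← hb2k, ← hr₁def]; exact hdip)
  constructor
  · linarith
  · rw [hσdef] at hsd; linarith

/-! ## Every finite block -/

/-- **The transiting modes of every finite block of `α_SB` relax, uniformly in small viscosity.**  For every
depth `K`, pocket cap `Z > 0` and level `ρ > 0` there are `T₀ > 0` and `ν₀ > 0` (depending on
`K, Z, ρ, ε₀` only) such that along every regular solution of the `ν`-viscous `α_SB` lattice on `[0,s]`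
with `0 < ν ≤ ν₀`, no shells below `0`, non-negative on the shells `≥ 0`, all pockets `≤ Z` on `[0,s]`:
**`x_k(u) ≤ ρ` and `s_k(u) ≤ ρ` for all `k ≤ K` and all `u ∈ [T₀, s]`.**  Induction on `K` with
`sideBranch_shell_transit_step`: the block `0..K` is driven to the level
`ρ' = min(ρ, √-free bound with Λ_K ρ'² ≤ φ_{K+1})`, after which shell `K+1` sees a quiet feed. [this file] -/
theorem sideBranch_block_transit_relax {ε₀ : ℝ} (hε : 0 < ε₀) {Z : ℝ} (hZ : 0 < Z) (K : ℕ) {ρ : ℝ}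
    (hρ : 0 < ρ) :
    ∃ T₀ : ℝ, 0 < T₀ ∧ ∃ ν₀ : ℝ, 0 < ν₀ ∧
      ∀ ν : ℝ, 0 < ν → ν ≤ ν₀ → ∀ (s : ℝ) (X : Fin 4 → ℤ → ℝ → ℝ),
        (∀ (i : Fin 4) (j : ℤ), j < 0 → ∀ t : ℝ, X i j t = 0) →
        (∀ (i : Fin 4) (j : ℤ), ∀ t ∈ Icc (0 : ℝ) s, HasDerivWithinAt (X i j)
          (quadTerm ε₀ sideBranchTable X i j t - ν * (1 + ε₀) ^ ((2 : ℝ) * j) * X i j t)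
          (Icc (0 : ℝ) s) t) →
        (∀ t ∈ Icc (0 : ℝ) s, ∀ (i : Fin 4) (j : ℤ), 0 ≤ j → 0 ≤ X i j t) →
        (∀ t ∈ Icc (0 : ℝ) s, ∀ j : ℤ, X 2 j t ≤ Z) →
        ∀ u ∈ Icc T₀ s, ∀ k : ℕ, k ≤ K → X 0 (k : ℤ) u ≤ ρ ∧ X 1 (k : ℤ) u ≤ ρ := by
  have hb : (0 : ℝ) < 1 + ε₀ := by linarith
  induction K generalizing ρ with
  | zero =>
    -- shell `0`: the feed is identically zero
    obtain ⟨φ, hφ, W, hW, ν₁, hν₁, hstep⟩ := sideBranch_shell_transit_step hε 0 le_rfl hZ hρ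
    refine ⟨W, hW, ν₁, hν₁, ?_⟩
    intro ν hν hνle s X hlow hder hpos hcap u hu k hk
    have hk0 : k = 0 := Nat.le_zero.1 hk
    subst hk0
    have hfeed : ∀ w ∈ Icc (0 : ℝ) s,
        (1 + ε₀) ^ ((5 : ℝ) * (((0 : ℤ) : ℝ) - 1) / 2) * X 0 (0 - 1) w ^ 2 ≤ φ := by
      intro w hw
      rw [hlow 0 (0 - 1) (by norm_num) w]
      simpa using hφ.le
    have h := hstep ν hν hνle s X hder hpos hcap 0 le_rfl hfeed u (by simpa using hu)
    simpa using h
  | succ K ih =>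
    -- shell `K+1` with its tolerance `φ`; the block `0..K` at the level `ρ'`
    obtain ⟨φ, hφ, W, hW, ν₁, hν₁, hstep⟩ :=
      sideBranch_shell_transit_step hε ((K : ℤ) + 1) (by positivity) hZ hρ
    set ΛK : ℝ := (1 + ε₀) ^ ((5 : ℝ) * (K : ℝ) / 2) with hΛK
    have hΛK0 : 0 < ΛK := Real.rpow_pos_of_pos hb _
    set ρ' : ℝ := min (min ρ 1) (φ / ΛK) with hρ'def
    have hρ' : 0 < ρ' := lt_min (lt_min hρ one_pos) (by positivity)
    have hρ'ρ : ρ' ≤ ρ := (min_le_left _ _).trans (min_le_left _ _)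
    have hρ'1 : ρ' ≤ 1 := (min_le_left _ _).trans (min_le_right _ _)
    have hρ'φ : ρ' ≤ φ / ΛK := min_le_right _ _
    obtain ⟨T₀', hT₀', ν₀', hν₀', hblock⟩ := ih hρ'
    refine ⟨T₀' + W, by linarith, min ν₀' ν₁, lt_min hν₀' hν₁, ?_⟩
    intro ν hν hνle s X hlow hder hpos hcap u hu k hk
    have hν0' : ν ≤ ν₀' := hνle.trans (min_le_left _ _)
    have hν1' : ν ≤ ν₁ := hνle.trans (min_le_right _ _)
    have hblock' := hblock ν hν hν0' s X hlow hder hpos hcap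
    rcases Nat.lt_or_ge k (K + 1) with hlt | hge
    · -- a shell of the old block
      have hkK : k ≤ K := Nat.lt_succ_iff.1 hlt
      have huT : u ∈ Icc T₀' s := ⟨by linarith [hu.1], hu.2⟩
      obtain ⟨h1, h2⟩ := hblock' u huT k hkK
      exact ⟨h1.trans hρ'ρ, h2.trans hρ'ρ⟩
    · -- the new top shell `K+1`: its feed `Λ_K x_K²` is quiet on `[T₀', s]`
      have hkeq : k = K + 1 := le_antisymm hk hge
      subst hkeq
      have hfeed : ∀ w ∈ Icc T₀' s,
          (1 + ε₀) ^ ((5 : ℝ) * ((((K : ℤ) + 1 : ℤ) : ℝ) - 1) / 2) * X 0 ((K : ℤ) + 1 - 1) w ^ 2 ≤ φ := by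
        intro w hw
        have hcast : (5 : ℝ) * ((((K : ℤ) + 1 : ℤ) : ℝ) - 1) / 2 = (5 : ℝ) * (K : ℝ) / 2 := by
          push_cast; ring
        rw [hcast, ← hΛK, add_sub_cancel_right]
        obtain ⟨hxK, -⟩ := hblock' w hw K le_rfl
        have hx0 : 0 ≤ X 0 (K : ℤ) w := hpos w ⟨hT₀'.le.trans hw.1, hw.2⟩ 0 (K : ℤ) (by positivity)
        have h1 : X 0 (K : ℤ) w ^ 2 ≤ ρ' ^ 2 := pow_le_pow_left₀ hx0 hxK 2
        have h2 : ρ' ^ 2 ≤ ρ' := by nlinarith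
        have h3 : ΛK * ρ' ≤ φ := by
          have := mul_le_mul_of_nonneg_left hρ'φ hΛK0.le
          rwa [mul_div_cancel₀ _ hΛK0.ne'] at this
        nlinarith
      have h := hstep ν hν hν1' s X hder hpos hcap T₀' hT₀'.le hfeed u ⟨by linarith [hu.1], hu.2⟩
      simpa using h

/-- **Energy form.** Under the conclusion of `sideBranch_block_transit_relax` (levels `ρ`) and
non-negativity: `Σ_{k ≤ K} (½x_k(u)² + ½s_k(u)²) ≤ (K+1)·ρ²`. [this file] -/
theorem sideBranch_block_transit_energy {X : Fin 4 → ℤ → ℝ → ℝ} {K : ℕ} {ρ u : ℝ}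
    (hpos : ∀ k : ℕ, k ≤ K → 0 ≤ X 0 (k : ℤ) u ∧ 0 ≤ X 1 (k : ℤ) u)
    (hle : ∀ k : ℕ, k ≤ K → X 0 (k : ℤ) u ≤ ρ ∧ X 1 (k : ℤ) u ≤ ρ) :
    (∑ k ∈ Finset.range (K + 1), ((1 / 2 : ℝ) * X 0 (k : ℤ) u ^ 2 + (1 / 2 : ℝ) * X 1 (k : ℤ) u ^ 2)) ≤
      ((K : ℝ) + 1) * ρ ^ 2 := by
  have h : ∀ k ∈ Finset.range (K + 1),
      (1 / 2 : ℝ) * X 0 (k : ℤ) u ^ 2 + (1 / 2 : ℝ) * X 1 (k : ℤ) u ^ 2 ≤ ρ ^ 2 := by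
    intro k hk
    have hkK : k ≤ K := Nat.lt_succ_iff.1 (Finset.mem_range.1 hk)
    obtain ⟨h0, h1⟩ := hpos k hkK
    obtain ⟨hx, hs⟩ := hle k hkK
    have h2 : X 0 (k : ℤ) u ^ 2 ≤ ρ ^ 2 := pow_le_pow_left₀ h0 hx 2
    have h3 : X 1 (k : ℤ) u ^ 2 ≤ ρ ^ 2 := pow_le_pow_left₀ h1 hs 2
    linarith
  calc (∑ k ∈ Finset.range (K + 1), ((1 / 2 : ℝ) * X 0 (k : ℤ) u ^ 2 + (1 / 2 : ℝ) * X 1 (k : ℤ) u ^ 2))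
      ≤ ∑ _k ∈ Finset.range (K + 1), ρ ^ 2 := Finset.sum_le_sum h
    _ = ((K : ℝ) + 1) * ρ ^ 2 := by simp [Finset.sum_const, Finset.card_range]

end Summit.NavierStokesRegularity.NavierStokesRegularity.Theorems.SubOnsagerCeiling

end
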